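import Summits.CriticalPhenomena.PercolationContinuityZ3.Theorems.PercNearOneGluingNoHeavyLowerTailSahiOneStepUniformMonoA
import HarnessLib

/-!
# One-step scheme: the phantom tail weights are non-increasing and LOG-CONCAVE

Support file (prover prim-ineq-prove-3 gen 31; `--supports stmt-CriticalPhenomena-4575`; memo
`run/shared/lean/prim/prim-ineq-prove-3/PROOF-G31-PHANTOM.md` §1–2).  No definitions, no named facts, no sorries, no `native_decide`.

Companion of `…SahiOneStepPhantom` (`osN_threshold_eq_phantom`): there the `(2′)` functional of a pair determined by `T ⊆ F` was rewritten with the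
weights `ω_k = μ{N_R + k < t}` of the phantom block `R = F ∖ T`.  THEOREM PH4 / CONJECTURE G need exactly three properties of `k ↦ ω_k`: values in
`[0,1]`, non-increasing, log-concave.  They are recorded here for every product measure and every block `R`:

* `real_phantomTail_eq_ball` — `μ{N_R + k < t} = μ{N_R < t − k}` (truncated subtraction);
* `real_ball_mono`, `real_phantomTail_antitone`, `real_phantomTail_le_one`;
* `real_ball_mul_layer_le` — `μ{N_R < u}·μ{N_R = u} ≤ μ{N_R = u−1}·μ{N_R < u+1}` (`u ≥ 1`; from the log-concavity of the layer masses, `real_layer_logConcave`);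
* `real_ball_logConcave` — `μ{N_R < u−1}·μ{N_R < u+1} ≤ μ{N_R < u}²` (`u ≥ 1`): the Poisson-binomial CDF is log-concave;
* `real_phantomTail_logConcave` — `ω_k·ω_{k+2} ≤ ω_{k+1}²`.
-/

noncomputable section

namespace Summit.CriticalPhenomena.PercolationContinuityZ3.Theorems

namespace SahiOneStep

open MeasureTheory Finset
open Literature.Probability.LatticeModels (prodBernoulli)
open scoped Classical

variable {ι : Type*} [Fintype ι] [DecidableEq ι]

omit [Fintype ι] [DecidableEq ι] in
/-- `{N_R + k < t} = {N_R < t − k}` (truncated subtraction), hence the same measure. [folklore] -/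
theorem real_phantomTail_eq_ball (p : ι → unitInterval) (R : Finset ι) (t k : ℕ) :
    (prodBernoulli p).real {ω : Set ι | (R.filter (· ∈ ω)).card + k < t} =
      (prodBernoulli p).real {ω : Set ι | (R.filter (· ∈ ω)).card < t - k} := by
  congr 1; ext ω; simp only [Set.mem_setOf_eq]; omega

omit [Fintype ι] [DecidableEq ι] in
/-- Balls grow: `u ≤ v → μ{N_R < u} ≤ μ{N_R < v}`. [folklore] -/
theorem real_ball_mono (p : ι → unitInterval) (R : Finset ι) {u v : ℕ} (huv : u ≤ v) :
    (prodBernoulli p).real {ω : Set ι | (R.filter (· ∈ ω)).card < u} ≤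
      (prodBernoulli p).real {ω : Set ι | (R.filter (· ∈ ω)).card < v} :=
  measureReal_mono (fun ω (hω : (R.filter (· ∈ ω)).card < u) => lt_of_lt_of_le hω huv)

omit [Fintype ι] [DecidableEq ι] in
/-- **The phantom tail weights are non-increasing**: `k ≤ k' → ω_{k'} ≤ ω_k`. [this work] -/
theorem real_phantomTail_antitone (p : ι → unitInterval) (R : Finset ι) (t : ℕ) {k k' : ℕ} (hkk' : k ≤ k') :
    (prodBernoulli p).real {ω : Set ι | (R.filter (· ∈ ω)).card + k' < t} ≤
      (prodBernoulli p).real {ω : Set ι | (R.filter (· ∈ ω)).card + k < t} := by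
  rw [real_phantomTail_eq_ball, real_phantomTail_eq_ball]
  exact real_ball_mono p R (by omega)

omit [Fintype ι] [DecidableEq ι] in
/-- The phantom tail weights lie in `[0,1]`. [folklore] -/
theorem real_phantomTail_le_one (p : ι → unitInterval) (R : Finset ι) (t k : ℕ) :
    (prodBernoulli p).real {ω : Set ι | (R.filter (· ∈ ω)).card + k < t} ≤ 1 :=
  measureReal_le_one

omit [DecidableEq ι] in
/-- **Ball × layer exchange** (`u ≥ 1`): `μ{N_R < u}·μ{N_R = u} ≤ μ{N_R = u−1}·μ{N_R < u+1}` — from `real_layer_logConcave`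
(`μ{N=r}μ{N=u} ≤ μ{N=r+1}μ{N=u−1}` for `r < u−1`) summed over `r < u`. [this work] -/
theorem real_ball_mul_layer_le (p : ι → unitInterval) (R : Finset ι) (u : ℕ) (hu : 1 ≤ u) :
    (prodBernoulli p).real {ω : Set ι | (R.filter (· ∈ ω)).card < u} *
        (prodBernoulli p).real {ω : Set ι | (R.filter (· ∈ ω)).card = u} ≤
      (prodBernoulli p).real {ω : Set ι | (R.filter (· ∈ ω)).card = u - 1} *
        (prodBernoulli p).real {ω : Set ι | (R.filter (· ∈ ω)).card < u + 1} := by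
  set d : ℕ → ℝ := fun r => (prodBernoulli p).real {ω : Set ι | (R.filter (· ∈ ω)).card = r} with hd
  have hd0 : ∀ r, 0 ≤ d r := fun r => measureReal_nonneg
  -- layer log-concavity in the needed form: `d r * d u ≤ d (r+1) * d (u-1)` for `r + 1 ≤ u - 1`, equality case `r = u - 1`
  have hlc : ∀ r, r < u → d r * d u ≤ d (r + 1) * d (u - 1) := by
    intro r hr
    rcases Nat.lt_or_ge (r + 1) u with h | h
    · -- `r < u - 1`: genuine log-concavity with `a = r`, `b = u - 1`
      have h' := real_layer_logConcave p R (a := r) (b := u - 1) (by omega)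
      rw [show u - 1 + 1 = u by omega] at h'
      exact h'
    · -- `r = u - 1`
      have hr' : r = u - 1 := by omega
      subst hr'
      rw [show u - 1 + 1 = u by omega, mul_comm]
  rw [real_ball_eq_sum p R u, real_ball_eq_sum p R (u + 1), Finset.sum_mul, Finset.mul_sum]
  -- Σ_{r<u} d r · d u ≤ Σ_{r<u} d (u-1) · d (r+1) ≤ d (u-1) · Σ_{s<u+1} d s
  calc ∑ r ∈ range u, d r * d u
      ≤ ∑ r ∈ range u, d (u - 1) * d (r + 1) :=
        Finset.sum_le_sum fun r hr => by rw [mul_comm (d (u-1))]; exact hlc r (Finset.mem_range.1 hr)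
    _ = ∑ s ∈ Finset.Ico 1 (u + 1), d (u - 1) * d s := by
        rw [Finset.sum_Ico_eq_sum_range]
        simp only [show u + 1 - 1 = u by omega]
        exact Finset.sum_congr rfl fun r _ => by rw [add_comm 1 r]
    _ ≤ ∑ s ∈ range (u + 1), d (u - 1) * d s := by
        refine Finset.sum_le_sum_of_subset_of_nonneg (fun s hs => ?_) (fun s _ _ => mul_nonneg (hd0 _) (hd0 _))
        rw [Finset.mem_Ico] at hs; exact Finset.mem_range.2 hs.2

omit [DecidableEq ι] in
/-- **The Poisson-binomial CDF is log-concave**: `μ{N_R < u−1}·μ{N_R < u+1} ≤ μ{N_R < u}²` for `u ≥ 1`. [this work] -/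
theorem real_ball_logConcave (p : ι → unitInterval) (R : Finset ι) (u : ℕ) (hu : 1 ≤ u) :
    (prodBernoulli p).real {ω : Set ι | (R.filter (· ∈ ω)).card < u - 1} *
        (prodBernoulli p).real {ω : Set ι | (R.filter (· ∈ ω)).card < u + 1} ≤
      (prodBernoulli p).real {ω : Set ι | (R.filter (· ∈ ω)).card < u} ^ 2 := by
  have hsucc := real_ball_succ p R u            -- D(u+1) = D(u) + d(u)
  have hpred : (prodBernoulli p).real {ω : Set ι | (R.filter (· ∈ ω)).card < u} =
      (prodBernoulli p).real {ω : Set ι | (R.filter (· ∈ ω)).card < u - 1} +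
        (prodBernoulli p).real {ω : Set ι | (R.filter (· ∈ ω)).card = u - 1} := by
    have h := real_ball_succ p R (u - 1)
    rw [show u - 1 + 1 = u by omega] at h
    exact h
  have hexch := real_ball_mul_layer_le p R u hu
  have hD0 : 0 ≤ (prodBernoulli p).real {ω : Set ι | (R.filter (· ∈ ω)).card < u - 1} := measureReal_nonneg
  have hdu : 0 ≤ (prodBernoulli p).real {ω : Set ι | (R.filter (· ∈ ω)).card = u} := measureReal_nonneg
  have hdu1 : 0 ≤ (prodBernoulli p).real {ω : Set ι | (R.filter (· ∈ ω)).card = u - 1} := measureReal_nonneg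
  rw [hsucc, hpred, sq]
  rw [hpred] at hexch
  nlinarith [hexch, mul_nonneg hD0 hdu, mul_nonneg hdu1 hdu]

omit [DecidableEq ι] in
/-- **The phantom tail weights are log-concave**: `ω_k·ω_{k+2} ≤ ω_{k+1}²`, `ω_k = μ{N_R + k < t}`. [this work] -/
theorem real_phantomTail_logConcave (p : ι → unitInterval) (R : Finset ι) (t k : ℕ) :
    (prodBernoulli p).real {ω : Set ι | (R.filter (· ∈ ω)).card + k < t} *
        (prodBernoulli p).real {ω : Set ι | (R.filter (· ∈ ω)).card + (k + 2) < t} ≤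
      (prodBernoulli p).real {ω : Set ι | (R.filter (· ∈ ω)).card + (k + 1) < t} ^ 2 := by
  rw [real_phantomTail_eq_ball, real_phantomTail_eq_ball, real_phantomTail_eq_ball]
  by_cases hk : k + 2 ≤ t
  · -- `u := t - (k+1) ≥ 1`, `t - k = u + 1`, `t - (k+2) = u - 1`
    have h := real_ball_logConcave p R (t - (k + 1)) (by omega)
    rw [show t - (k + 1) - 1 = t - (k + 2) by omega, show t - (k + 1) + 1 = t - k by omega] at h
    rw [mul_comm]; exact h
  · -- the smallest ball is empty
    have h0 : {ω : Set ι | (R.filter (· ∈ ω)).card < t - (k + 2)} = ∅ := by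
      ext ω; simp only [Set.mem_setOf_eq, Set.mem_empty_iff_false, iff_false]; omega
    rw [h0, measureReal_empty, mul_zero]
    exact sq_nonneg _

end SahiOneStep

end Summit.CriticalPhenomena.PercolationContinuityZ3.Theorems
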